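import Literature.Topology.FourManifolds.LatticeFormsEichlerCriterion
import HarnessLib

/-!
# The Eichler criterion for isotropic vectors (GHS 2009, Prop. 3.3 (i); Wall 1963)

Topic `Literature/Topology/FourManifolds`; sequel of `LatticeFormsEichlerCriterion.lean` (GHS
Lemma 3.2) in the algebraic half of the proof architecture of Kirby 1989 Ch. X Thm. 2
(`WallDiffeomorphisms.lean`), vendored from V. Gritsenko, K. Hulek, G. K. Sankaran,
*Abelianisation of orthogonal groups and the fundamental group of modular varieties*, J. Algebra
322 (2009), §3, Prop. 3.3 (i) ("the Eichler criterion", "essentially to be found in [Ei]" =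
Eichler, *Quadratische Formen und orthogonale Gruppen* (1952), §10) in the case needed for
Prop. 3.3 (iii) (`O(L) = ⟨E_U(L₁), O(L₁)⟩`, "proved in [Wa] for unimodular lattices", [Wa] =
Wall 1963 = Kirby's [Wall4]): **an isotropic vector `u` with a dual vector (`u·z = 1`) is carried
to `y` by an admissible word in the transvections `E(y, a, q)`, `E(x, a, q)`, `a ⊥ U`**
(`exists_uGens_apply_eq`), for a symmetric *even* integral form with two orthogonal hyperbolic
pairs `(x, y)`, `(x₁, y₁)`. No unimodularity is needed (the dual vector of `φ(y)`, `φ` an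
isometry, is `φ(x)`).

Printed proof (GHS p. 469): (1) by Lemma 3.2 move `u` and the target into `L₁ = U^⊥`
(`exists_uGens_ortho`); (2) "we can realise the translation by `w = (u - v)/d` in the sublattice
`L₁` orthogonal to `U` as a composition of Eichler transvections:
`u ↦^{t(e,u')} (u - de) ↦^{t(f,w)} (v - de) ↦^{t(e,-v')} v`, where `u', v' ∈ L₁` are such that
`(u,u') = (v,v') = d`" — here `eichler_translation` (any `d ≠ 0`; used with `d = 1`); (3) undo
the word that moved the target (inverse words, `UGen.invWord`). Evenness enters exactly in (2):
the transvections `t(e,u')`, `t(f,w)`, `t(e,-v')` need the half-squares of `u', w, v'`.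

Everything is proved; no named fact is introduced. NOT here: the general Eichler criterion
(arbitrary `(u,u)`, divisor `d`, `u* ≡ v* mod L`), nor Prop. 3.3 (ii)–(iv).

## Sources

* V. Gritsenko, K. Hulek, G. K. Sankaran, J. Algebra 322 (2009) 463–478, arXiv:0810.1614,
  Prop. 3.3 (i) and its proof (p. 469). [GritsenkoHulekSankaran2009]
* M. Eichler, *Quadratische Formen und orthogonale Gruppen* (1952), §10; C. T. C. Wall, *On the
  orthogonal groups of unimodular quadratic forms II*, J. reine angew. Math. 213 (1963) 122–136
  (neither held; cited through GHS).
-/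

noncomputable section

open Module
open LinearMap (BilinForm)

namespace Literature.Topology.FourManifolds

variable {W : Type*} [AddCommGroup W] {B : BilinForm ℤ W} {x y : W}

/-! ### Inverse words -/

namespace UGen

/-- The inverse generator: `E(e, a, q)⁻¹ = E(e, -a, q)` (GHS (t3): `t(e,a)⁻¹ = t(e,-a)`).
[cite: GritsenkoHulekSankaran2009, §3.1 (t3)] -/
def inv : UGen W → UGen W
  | atY a q => atY (-a) q
  | atX a q => atX (-a) q

/-- The inverse of an admissible generator is admissible. [folklore] -/
theorem isAdmissible_inv {g : UGen W} (hg : g.IsAdmissible B x y) : g.inv.IsAdmissible B x y := by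
  cases g with
  | atY a q =>
    obtain ⟨hxa, hya, hq⟩ := hg
    exact ⟨by simp [hxa], by simp [hya], by simpa using hq⟩
  | atX a q =>
    obtain ⟨hxa, hya, hq⟩ := hg
    exact ⟨by simp [hxa], by simp [hya], by simpa using hq⟩

/-- `g⁻¹ ∘ g = 1` for an admissible generator (`B` symmetric, `x`, `y` isotropic).
[cite: GritsenkoHulekSankaran2009, §3.1 (t3)] -/
theorem inv_comp (hB : B.IsSymm) (hxx : B x x = 0) (hyy : B y y = 0) {g : UGen W}
    (hg : g.IsAdmissible B x y) :
    g.inv.toLinearMap B x y ∘ₗ g.toLinearMap B x y = LinearMap.id := by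
  cases g with
  | atY a q =>
    obtain ⟨-, hya, hq⟩ := hg
    exact B.eichlerTransvection_neg_comp hB hyy hya hq
  | atX a q =>
    obtain ⟨hxa, -, hq⟩ := hg
    exact B.eichlerTransvection_neg_comp hB hxx hxa hq

/-- The inverse word: reverse the word and invert each generator. [folklore] -/
def invWord (l : List (UGen W)) : List (UGen W) := (l.map inv).reverse

/-- Members of the inverse word of an admissible word are admissible. [folklore] -/
theorem isAdmissible_of_mem_invWord {l : List (UGen W)} (hl : ∀ g ∈ l, g.IsAdmissible B x y)
    {g : UGen W} (hg : g ∈ invWord l) : g.IsAdmissible B x y := by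
  simp only [invWord, List.mem_reverse, List.mem_map] at hg
  obtain ⟨g', hg', rfl⟩ := hg
  exact isAdmissible_inv (hl g' hg')

/-- `invWord (g :: l) = invWord l ++ [g⁻¹]`. [folklore] -/
theorem invWord_cons (g : UGen W) (l : List (UGen W)) :
    invWord (g :: l) = invWord l ++ [g.inv] := by
  simp [invWord]

/-- **An admissible word is undone by its inverse word**: `eval (invWord l) (eval l u) = u`.
[cite: GritsenkoHulekSankaran2009, §3.1 (t3)] -/
theorem eval_invWord_eval (hB : B.IsSymm) (hxx : B x x = 0) (hyy : B y y = 0) {l : List (UGen W)}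
    (hl : ∀ g ∈ l, g.IsAdmissible B x y) (u : W) :
    eval B x y (invWord l) (eval B x y l u) = u := by
  induction l generalizing u with
  | nil => rfl
  | cons g l ih =>
    have hg : g.IsAdmissible B x y := hl g List.mem_cons_self
    rw [invWord_cons, eval_append, LinearMap.comp_apply, eval_cons, eval_nil,
      LinearMap.comp_id, eval_cons, LinearMap.comp_apply, ← LinearMap.comp_apply
      (g.inv.toLinearMap B x y), inv_comp hB hxx hyy hg, LinearMap.id_apply]
    exact ih (fun g' hg' => hl g' (List.mem_cons_of_mem g hg')) u

/-! ### Admissible words as isometries -/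

/-- An admissible generator as a bundled isometry (`IsometryEquiv.eichlerTransvection`).
[cite: GritsenkoHulekSankaran2009, §3.1 (t2)] -/
def toIsometryEquiv (hB : B.IsSymm) (hxx : B x x = 0) (hyy : B y y = 0) :
    (g : UGen W) → g.IsAdmissible B x y → B.IsometryEquiv B
  | atY a q, hg => LinearMap.BilinForm.IsometryEquiv.eichlerTransvection B hB y a q hyy hg.2.1 hg.2.2
  | atX a q, hg => LinearMap.BilinForm.IsometryEquiv.eichlerTransvection B hB x a q hxx hg.1 hg.2.2

/-- The bundled generator acts by `toLinearMap`. [folklore] -/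
@[simp]
theorem toIsometryEquiv_apply (hB : B.IsSymm) (hxx : B x x = 0) (hyy : B y y = 0) (g : UGen W)
    (hg : g.IsAdmissible B x y) (u : W) :
    toIsometryEquiv hB hxx hyy g hg u = g.toLinearMap B x y u := by
  cases g <;> rfl

/-- An admissible word as a bundled isometry (composite of the bundled generators, the head
applied last). [folklore] -/
def evalEquiv (hB : B.IsSymm) (hxx : B x x = 0) (hyy : B y y = 0) :
    (l : List (UGen W)) → (∀ g ∈ l, g.IsAdmissible B x y) → B.IsometryEquiv B
  | [], _ => LinearMap.BilinForm.IsometryEquiv.refl B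
  | g :: l, hl =>
    (evalEquiv hB hxx hyy l fun g' hg' => hl g' (List.mem_cons_of_mem g hg')).trans
      (toIsometryEquiv hB hxx hyy g (hl g List.mem_cons_self))

/-- The bundled word acts by `eval`. [folklore] -/
@[simp]
theorem evalEquiv_apply (hB : B.IsSymm) (hxx : B x x = 0) (hyy : B y y = 0) (l : List (UGen W))
    (hl : ∀ g ∈ l, g.IsAdmissible B x y) (u : W) :
    evalEquiv hB hxx hyy l hl u = eval B x y l u := by
  induction l with
  | nil => rfl
  | cons g l ih =>
    change toIsometryEquiv hB hxx hyy g _ (evalEquiv hB hxx hyy l _ u) = _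
    rw [toIsometryEquiv_apply, ih, eval_cons, LinearMap.comp_apply]

end UGen

/-! ### The translation trick -/

/-- **GHS's chain of three transvections** realising a translation in `U^⊥`: for `B` symmetric,
`y` isotropic, `x·y = 1`; `u ⊥ U`, `v, w, v' ⊥ y`; `d w = u - v` with `d ≠ 0`; `u·u = v·v`;
`u·u' = v·v' = d`; `w·w = 2q₂`:
`E(y, -v', q₃) (E(x, w, q₂) (E(y, u', q₁) u)) = v`
("`u ↦^{t(e,u')} (u - de) ↦^{t(f,w)} (v - de) ↦^{t(e,-v')} v`").
[cite: GritsenkoHulekSankaran2009, Prop. 3.3 (i), proof] -/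
theorem eichler_translation (hB : B.IsSymm) (hyy : B y y = 0) (hxy : B x y = 1)
    {u v w u' v' : W} {d q₁ q₂ q₃ : ℤ} (hd : d ≠ 0)
    (hxu : B x u = 0) (hyu : B y u = 0) (hyv : B y v = 0) (hyw : B y w = 0) (hyv' : B y v' = 0)
    (hw : d • w = u - v) (huv : B u u = B v v) (hu' : B u u' = d) (hv' : B v v' = d)
    (hq₂ : B w w = q₂ + q₂) :
    B.eichlerTransvection y (-v') q₃
      (B.eichlerTransvection x w q₂ (B.eichlerTransvection y u' q₁ u)) = v := by
  -- the scalar identity `w·u = q₂ d`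
  have hwy : B w y = 0 := by rw [hB.eq, hyw]
  have e1 : d * B w u = B u u - B u v := by
    have h1 : B (d • w) u = B (u - v) u := by rw [hw]
    simp only [map_smul, LinearMap.smul_apply, smul_eq_mul, map_sub, LinearMap.sub_apply] at h1
    rw [hB.eq v u] at h1
    exact h1
  have e2 : d * d * (q₂ + q₂) = (B u u - B u v) + (B u u - B u v) := by
    have h2 : B (d • w) (d • w) = B (u - v) (u - v) := by rw [hw]
    simp only [map_smul, LinearMap.smul_apply, smul_eq_mul, map_sub, LinearMap.sub_apply] at h2
    rw [hq₂, hB.eq v u, ← huv] at h2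
    linarith
  have hwu : B w u = q₂ * d := by
    have h3 : d * (d * (q₂ + q₂)) = d * (2 * B w u) := by
      rw [← mul_assoc, e2, ← e1]
      ring
    have h4 := mul_left_cancel₀ hd h3
    linarith
  -- step 1: `E(y, u', q₁) u = u - d y`
  have s1 : B.eichlerTransvection y u' q₁ u = u - d • y := by
    rw [B.eichlerTransvection_apply, hyu, hB.eq u' u, hu']
    simp
  -- step 2: `E(x, w, q₂) (u - d y) = v - d y`
  have s2 : B.eichlerTransvection x w q₂ (u - d • y) = v - d • y := by
    have hx1 : B x (u - d • y) = -d := by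
      rw [map_sub, map_smul, hxu, hxy, smul_eq_mul, mul_one, zero_sub]
    have hw1 : B w (u - d • y) = q₂ * d := by
      rw [map_sub, map_smul, hwu, hwy, smul_zero, sub_zero]
    rw [B.eichlerTransvection_apply, hx1, hw1]
    have : u - d • y + -d • w = v - d • y := by
      rw [neg_smul, hw]
      abel
    rw [← this]
    module
  -- step 3: `E(y, -v', q₃) (v - d y) = v`
  have s3 : B.eichlerTransvection y (-v') q₃ (v - d • y) = v := by
    have hy1 : B y (v - d • y) = 0 := by
      rw [map_sub, map_smul, hyv, hyy, smul_zero, sub_zero]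
    have hv1 : B (-v') (v - d • y) = -d := by
      rw [map_neg, LinearMap.neg_apply, map_sub, map_smul, hB.eq v' v, hv', hB.eq v' y, hyv',
        smul_zero, sub_zero]
    rw [B.eichlerTransvection_apply, hy1, hv1]
    module
  rw [s1, s2, s3]

/-! ### The Eichler criterion for isotropic vectors with a dual vector -/

section Transitive

variable {x₁ y₁ : W} (h : TwoHyperbolicPairs B x y x₁ y₁)
include h

/-- Projection to `U^⊥` keeping the product with a vector of `U^⊥`: for `z ∈ W` and `u ⊥ U`,
`z' = z - (y·z) x - (x·z) y` has `x·z' = y·z' = 0` and `u·z' = u·z`. [folklore] -/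
theorem exists_dual_ortho {u z : W} (hxu : B x u = 0) (hyu : B y u = 0) :
    B x (z - B y z • x - B x z • y) = 0 ∧ B y (z - B y z • x - B x z • y) = 0 ∧
      B u (z - B y z • x - B x z • y) = B u z := by
  have hux : B u x = 0 := by rw [h.isSymm.eq, hxu]
  have huy : B u y = 0 := by rw [h.isSymm.eq, hyu]
  refine ⟨?_, ?_, ?_⟩
  · simp [h.xx, h.xy]
  · simp [h.yy, h.yx]
  · simp [hux, huy]

/-- **Eichler criterion, isotropic case with a dual vector** (GHS Prop. 3.3 (i) for `(u,u) = 0`,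
`div(u) = 1`, target `y`): in a symmetric even integral bilinear module with two orthogonal
hyperbolic pairs `(x, y)`, `(x₁, y₁)`, every isotropic `u` having some `z` with `u·z = 1` is
carried to `y` by an admissible word in the Eichler transvections `E(y, a, q)`, `E(x, a, q)`
(`a ⊥ x, y`, `a·a = 2q`) — GHS's "there exists `τ ∈ E_U(L₁)` such that `τ(u) = v`" with
`v = e`. Proof as printed: move `u` and `y` into `U^⊥` by Lemma 3.2 (`exists_uGens_ortho`),
translate by three transvections (`eichler_translation`, `d = 1`), and undo the word that
moved `y`. [cite: GritsenkoHulekSankaran2009, Prop. 3.3 (i)] -/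
theorem exists_uGens_apply_eq (hev : B.IsEven) {u z : W} (hu : B u u = 0) (huz : B u z = 1) :
    ∃ l : List (UGen W), (∀ g ∈ l, g.IsAdmissible B x y) ∧ UGen.eval B x y l u = y := by
  have hB := h.isSymm
  -- (1) move `u` into `U^⊥`, with a dual vector there
  obtain ⟨l₁, hl₁, hxu₁, hyu₁⟩ := exists_uGens_ortho h u
  set u₁ := UGen.eval B x y l₁ u with hu₁def
  have hu₁ : B u₁ u₁ = 0 := by rw [UGen.map_eval hB h.xx h.yy hl₁, hu]
  obtain ⟨hxu', hyu', huu'⟩ := exists_dual_ortho h (z := UGen.eval B x y l₁ z) hxu₁ hyu₁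
  rw [UGen.map_eval hB h.xx h.yy hl₁, huz] at huu'
  set u' := UGen.eval B x y l₁ z - B y (UGen.eval B x y l₁ z) • x - B x (UGen.eval B x y l₁ z) • y
  -- (1') move `y` into `U^⊥`, with a dual vector there (the image of `x`)
  obtain ⟨l₂, hl₂, hxv₁, hyv₁⟩ := exists_uGens_ortho h y
  set v₁ := UGen.eval B x y l₂ y with hv₁def
  have hv₁ : B v₁ v₁ = 0 := by rw [UGen.map_eval hB h.xx h.yy hl₂, h.yy]
  obtain ⟨hxv', hyv', hvv'⟩ := exists_dual_ortho h (z := UGen.eval B x y l₂ x) hxv₁ hyv₁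
  rw [UGen.map_eval hB h.xx h.yy hl₂, h.yx] at hvv'
  set v' := UGen.eval B x y l₂ x - B y (UGen.eval B x y l₂ x) • x - B x (UGen.eval B x y l₂ x) • y
  -- (2) translate `u₁ ↦ v₁` inside `U^⊥`
  obtain ⟨q₁, hq₁⟩ := hev u'
  obtain ⟨q₂, hq₂⟩ := hev (u₁ - v₁)
  obtain ⟨q₃, hq₃⟩ := hev v'
  have hyw : B y (u₁ - v₁) = 0 := by rw [map_sub, hyu₁, hyv₁, sub_zero]
  have hxw : B x (u₁ - v₁) = 0 := by rw [map_sub, hxu₁, hxv₁, sub_zero]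
  have key := eichler_translation (q₁ := q₁) (q₃ := q₃) hB h.yy h.xy one_ne_zero hxu₁ hyu₁ hyv₁
    hyw hyv' (one_smul ℤ (u₁ - v₁)) (hu₁.trans hv₁.symm) huu' hvv' hq₂
  -- (3) the word: undo `l₂` after the three transvections after `l₁`
  refine ⟨UGen.invWord l₂ ++ ([UGen.atY (-v') q₃, UGen.atX (u₁ - v₁) q₂, UGen.atY u' q₁] ++ l₁),
    ?_, ?_⟩
  · intro g hg
    simp only [List.mem_append, List.mem_cons, List.not_mem_nil, or_false] at hg
    rcases hg with hg | (rfl | rfl | rfl) | hg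
    · exact UGen.isAdmissible_of_mem_invWord hl₂ hg
    · exact ⟨by simp [hxv'], by simp [hyv'], by simpa using hq₃⟩
    · exact ⟨hxw, hyw, hq₂⟩
    · exact ⟨hxu', hyu', hq₁⟩
    · exact hl₁ g hg
  · rw [UGen.eval_append, LinearMap.comp_apply, UGen.eval_append, LinearMap.comp_apply,
      ← hu₁def]
    change UGen.eval B x y (UGen.invWord l₂) (B.eichlerTransvection y (-v') q₃
      (B.eichlerTransvection x (u₁ - v₁) q₂ (B.eichlerTransvection y u' q₁ u₁))) = y
    rw [key, hv₁def, UGen.eval_invWord_eval hB h.xx h.yy hl₂]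

end Transitive

end Literature.Topology.FourManifolds

end
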